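import Summits.ValiantsHypothesis.ValiantsHypothesis.Theorems.EquivariantDialLocalShrinking
import HarnessLib

/-!
# The equivariant dial — NOTCH TRANSFER: Theorem H at every finite notch (lens-1 NODE g29, F1)

Support file for `stmt-ValiantsHypothesis-23702` (route DefinabilityGap, crux `CollapseToVPws`):
the representation-theoretic obstruction-splitting dial of `EquivariantDialNode`, read BELOW the
window `𝔖_m × 𝔖_m`.

Up to g28 the lineage's transfer machinery (local shrinking `A ⟹ A_loc`, finite lift groups
`A_loc ⟹ A_fin`, Levi gauge, block gauge, layering) was assembled only AT THE WINDOW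
`H = biPermSubst`.  Every step of it is generic in the symmetry group once two inputs are
available: FINITENESS of `H_m` for `m ≥ 3` (the finite lift group and the Maschke/Levi averaging)
and the `per_2` pad at `m = 2` (which is `𝔖_2 × 𝔖_2`-equivariant, hence equivariant for every
`H_2 ≤ 𝔖_2 × 𝔖_2`).  This file records the consequence:

* `blockGaugeCost_of_finite` — **Theorem H (block-gauge form) at every notch family `H` with
  `H_m` finite for `m ≥ 3` and `H_2 ≤ 𝔖_2 × 𝔖_2`**: every `H_m`-equivariant affine determinantal
  representation of `per_m` of size `s` admits an `H_m`-equivariant block gauge of inner size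
  `≤ 2 (m + s + 1)`.  In particular (`blockGaugeCost_of_le`) at every SUB-WINDOW family
  `H ≤ biPermSubst` — one-sided `𝔖_m × 1`, diagonal `Δ𝔖_m`, cyclic, Young subgroups, the trivial
  group — and at the window itself (`blockGaugeCost_biPermSubst`, `gradingCost_biPermSubst`,
  `layeringCost_biPermSubst`: the typed stubs `BlockGaugeCost / GradingCost / LayeringCost
  biPermSubst` of NODE-g13/g14, "Theorem H … to be kernelled" in `EquivariantDialGrading`, are
  now theorems).
* the TRANSFER corollaries at every such notch: `LayeringFree H`, `GradingFree H`,
  `EqHard H ↔ EqHardLayered H ↔ EqHard (graded H)`, `PolyEquivariant H ↔ PolyLayered H`, and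
  `IdealWidthSuperpoly H → EqHard H` — so for every finite notch the hardness piece `A_H` of the
  dial IS the layered piece `A^lay_H`, and the typed, instrumentable leaf `R^lay_H`
  (superpolynomial `H_m`-equivariant ideal width of `per_m`) suffices for it.
* the BOTTOM ANCHOR (`H = ⊥`, where `A_⊥ ⟺ W` by `eqHard_bot_iff`):
  `dcPerSuperpolynomial_iff_eqHardLayered_bot` — `W ⟺` "no polynomial-width layered program of
  the `LayeredABP` shape for `per_m`" (kernel form of the classical `dc ≈` branching-program
  width relation) — and `dcPerSuperpolynomial_of_idealWidthSuperpoly_bot` — `W` FOLLOWS from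
  superpolynomial plain (non-equivariant) ideal width of `per_m`, i.e. from a superpolynomial
  lower bound on `min {r : per_m ∈ (g_1, …, g_r), deg g_i = d}` at suitable cuts `d ≤ m`
  (the premise of the ideal/variety method for branching programs, whose results in print are
  quadratic).

So the dial now has two kernel anchors — window: `A ⟺ A^lay ⟸ R^lay`, all three PROVED
(g25–g28); bottom: `A_⊥ ⟺ W ⟺ A^lay_⊥ ⟸ R^lay_⊥` — and at every finite notch in between the
same shape `A_H ⟺ A^lay_H ⟸ R^lay_H` with `W ⟹ A_H` (`eqHard_of_dcPerSuperpolynomial`) and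
`A_H, R^lay_H` OPEN for `⊥ < H < 𝔖_m × 𝔖_m` (Landsberg 2017, p. 194: "what is `edc` for, e.g.,
one-sided, diagonal or cyclic symmetry?").

Method.  Classical (Fitting/Krull–Schmidt local shrinking, finite lift groups, Maschke averaging,
corank-one normal form); von zur Gathen's rank theorem enters through the Literature theorem
`vonzurGathen1987_perm_detRepr_rank_holds` (proved in the tree, not a hypothesis).

TRANSFER / bookkeeping in the sense of LESSON 6: the sub-window iffs relate OPEN statements and
prove NO lower bound; every cell A_H with ⊥ < H < 𝔖_m × 𝔖_m stays UNDECIDED; the bottom anchor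
REFORMULATES W (a costume of W as a piece) and its sufficient condition IdealWidthSuperpoly ⊥
(superpolynomial restricted strength of per_m) is summit-hard, with the print ceiling of the
strength method (Gesmundo–Ghosal–Ikenmeyer–Lysikov 2022, Prop. 6 / Remark 7: quadratic)
recorded, not attacked.

Labels (critic K5).  Restricted-model lower-bound infrastructure (necessity side), inside the
equivariance barrier; 0 S-currency; closes NO item; `DcPerSuperpolynomial` / VP ≠ VNP untouched
(the bottom anchor REFORMULATES `W`, it does not prove it).  Non-vacuity (K6): the hypotheses of
`blockGaugeCost_of_finite` are met by every `H ≤ biPermSubst` (`finite_of_le_biPermSubst`), the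
model is inhabited at `m = 2` by the signed representation `per_2 = det [[x₁₁, -x₁₂], [x₂₁, x₂₂]]`
(`hasBlockGaugeRepr_perPoly_two`), and at `H = ⊥` by every affine determinantal representation of
`per_m` (Grenet's, of size `2^m - 1`).
[cite: LandsbergRessayre2017, Def. 1.3, §3.6]; [cite: Vonzurgathen1987].
-/

set_option linter.dupNamespace false

namespace Summit.ValiantsHypothesis.ValiantsHypothesis.Theorems.EquivariantDialNotchTransfer

noncomputable section

open MvPolynomial Matrix
open Literature.Computability.AlgebraicComplexity
open Summit.ValiantsHypothesis.ValiantsHypothesis.Theorems.EquivariantDialNode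
open Summit.ValiantsHypothesis.ValiantsHypothesis.Theorems.EquivariantDialGrading
open Summit.ValiantsHypothesis.ValiantsHypothesis.Theorems.EquivariantDialLayers
open Summit.ValiantsHypothesis.ValiantsHypothesis.Theorems.EquivariantDialLeviGauge
open Summit.ValiantsHypothesis.ValiantsHypothesis.Theorems.EquivariantDialFiniteLifts
open Summit.ValiantsHypothesis.ValiantsHypothesis.Theorems.EquivariantDialPairAlgebra
open Summit.ValiantsHypothesis.ValiantsHypothesis.Theorems.EquivariantDialCornerDescent
open Summit.ValiantsHypothesis.ValiantsHypothesis.Theorems.EquivariantDialFiniteSupplement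
open Summit.ValiantsHypothesis.ValiantsHypothesis.Theorems.EquivariantDialLocalShrinking

/-! ## §1 Local shrinking and finite lift groups at an arbitrary notch -/

/-- LOCAL SHRINKING AT ANY NOTCH `Γ ≤ GL(m²)`: a `Γ`-equivariant affine determinantal representation
of `per_m` has a `Γ`-equivariant LOCAL direct summand (no invertible entries; of size `≤` the
original) which is again a representation of `per_m` — the proof of `localShrinking`, which never
used the window. -/
theorem exists_local_of_isEquivariantDetRepr {m s : ℕ} {Γ : Subgroup (GL (Fin m × Fin m) ℂ)}
    {A : Matrix (Fin s) (Fin s) (MvPolynomial (Fin m × Fin m) ℂ)}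
    (hA : IsEquivariantDetRepr Γ (perPoly (Fin m) ℂ) A) :
    ∃ s' : ℕ, s' ≤ s ∧ ∃ A' : Matrix (Fin s') (Fin s') (MvPolynomial (Fin m × Fin m) ℂ),
      IsEquivariantDetRepr Γ (perPoly (Fin m) ℂ) A' ∧ IsLocalRepr A' := by
  rcases Nat.eq_zero_or_pos m with hm | hm
  · subst hm
    refine ⟨0, Nat.zero_le _, 0,
      ⟨⟨fun i _ => i.elim0, ?_⟩, fun _ _ => ⟨1, 1, Subsingleton.elim _ _⟩⟩, fun y _ => ⟨0, ?_⟩⟩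
    · rw [Matrix.det_isEmpty]
      exact (Matrix.permanent_isEmpty (A := Matrix.mvPolynomialX (Fin 0) (Fin 0) ℂ)).symm
    · rw [map_zero, sub_zero, Subsingleton.elim y 0]
      exact IsNilpotent.zero
  · haveI : Nonempty (Fin m) := ⟨⟨0, hm⟩⟩
    have hprime : Prime (perPoly (Fin m) ℂ) :=
      UniqueFactorizationMonoid.irreducible_iff_prime.mp perPoly_irreducible
    obtain ⟨hAff, hlifts⟩ := isEquivariantDetRepr_iff_exists_mul_mul.mp hA
    obtain ⟨r, ι, _, _, e, U, V, P, Q, cQ, hrs, hblock, hdegP, hdetP, hlocP, hcQ, hdetQ⟩ :=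
      exists_local_corner hprime s A hAff.1 hAff.2
    have hliftsB := lifts_of_block hlifts U V e hblock
    refine ⟨r, hrs, P, isEquivariantDetRepr_iff_exists_mul_mul.mpr ⟨⟨hdegP, hdetP⟩, fun γ hγ => ?_⟩,
      hlocP⟩
    obtain ⟨G, H, hGH⟩ := hliftsB γ hγ
    exact corner_lift hprime hlocP hdetP hcQ hdetQ γ G H hGH

/-- FINITE LIFTS AT ANY FINITE NOTCH: for finite `Γ`, a `Γ`-equivariant representation of `per_m`
of size `s` yields one of size `≤ s` whose lifts range over a FINITE subgroup of `GL_s × GL_s`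
(local shrinking, then `isFinEquivariantDetRepr_of_isLocalRepr`). -/
theorem exists_finLift_of_isEquivariantDetRepr {m s : ℕ} {Γ : Subgroup (GL (Fin m × Fin m) ℂ)}
    [Finite Γ] {A : Matrix (Fin s) (Fin s) (MvPolynomial (Fin m × Fin m) ℂ)}
    (hA : IsEquivariantDetRepr Γ (perPoly (Fin m) ℂ) A) :
    ∃ s' : ℕ, s' ≤ s ∧ ∃ A' : Matrix (Fin s') (Fin s') (MvPolynomial (Fin m × Fin m) ℂ),
      IsFinEquivariantDetRepr Γ (perPoly (Fin m) ℂ) A' := by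
  obtain ⟨s', hs', A', hA', hloc⟩ := exists_local_of_isEquivariantDetRepr hA
  refine ⟨s', hs', A', ?_⟩
  rcases Nat.eq_zero_or_pos s' with h0 | hpos
  · subst h0
    exact isFinEquivariantDetRepr_of_size_zero hA'
  · exact isFinEquivariantDetRepr_of_isLocalRepr hpos hA' hloc

/-- BLOCK GAUGE FROM FINITE LIFTS AT ANY NOTCH (`m ≥ 3`): corank-one regularity (von zur Gathen),
Levi gauge by averaging over the finite lift group, then the tree's arrow
`hasBlockGaugeRepr_of_hasLeviLiftsAt`; the inner size is `s - 1`. -/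
theorem hasBlockGaugeRepr_of_finLifts {m s : ℕ} (hm : 3 ≤ m) {Γ : Subgroup (GL (Fin m × Fin m) ℂ)}
    {A : Matrix (Fin s) (Fin s) (MvPolynomial (Fin m × Fin m) ℂ)}
    (hA : IsFinEquivariantDetRepr Γ (perPoly (Fin m) ℂ) A) :
    ∃ N : ℕ, N + 1 = s ∧ HasBlockGaugeRepr Γ (perPoly (Fin m) ℂ) N := by
  obtain ⟨hA0, F, hF, hlift⟩ := hA
  haveI : Finite F := hF
  obtain ⟨A', i₀, hA', hL⟩ := exists_hasLeviLiftsAt_of_finLifts (size_pos_of_isAffineDetRepr (by omega) hA0)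
    (isRegularDetRepr_perPoly vonzurGathen1987_perm_detRepr_rank_holds hm hA0) F.subtype
    (fun γ hγ => by obtain ⟨p, hp, e⟩ := hlift γ hγ; exact ⟨⟨p, hp⟩, e⟩)
  cases s with
  | zero => exact i₀.elim0
  | succ N => exact ⟨N, rfl, hasBlockGaugeRepr_of_hasLeviLiftsAt hA' hL⟩

/-- Block-gauge data is inherited by subgroups. -/
theorem hasBlockGaugeRepr_anti {σ k : Type*} [Field k] [Fintype σ] [DecidableEq σ]
    {Γ Γ' : Subgroup (GL σ k)} {f : MvPolynomial σ k} {N : ℕ} (h : HasBlockGaugeRepr Γ f N)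
    (hle : Γ' ≤ Γ) : HasBlockGaugeRepr Γ' f N := by
  obtain ⟨B, hdet, hB⟩ := h
  exact ⟨B, hdet, fun γ hγ => hB γ (hle hγ)⟩

/-- Subgroups of the window group are finite. -/
theorem finite_of_le_biPermSubst {m : ℕ} {Γ : Subgroup (GL (Fin m × Fin m) ℂ)} (hle : Γ ≤ biPermSubst m) :
    Finite Γ :=
  haveI := finite_biPermSubst m
  Finite.of_injective _ (Subgroup.inclusion_injective hle)

/-! ## §2 Theorem H at every finite notch -/

variable {H : ∀ m : ℕ, Subgroup (GL (Fin m × Fin m) ℂ)}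

/-- ★ **THEOREM H, block-gauge form, at every finite notch**: if `H_2 ≤ 𝔖_2 × 𝔖_2` and `H_m` is
finite for `m ≥ 3`, every `H_m`-equivariant affine determinantal representation of `per_m`
(`m ≥ 2`) of size `s` can be brought into `H_m`-equivariant block gauge of inner size
`≤ 2 (m + s + 1)`.  ★ Labels: restricted-model infrastructure, inside the equivariance barrier;
0 S-currency; closes NO item; `DcPerSuperpolynomial` / VP ≠ VNP untouched.
[Theorem H kernelled · 0 S-currency · closes no item] -/
theorem blockGaugeCost_of_finite (h2 : H 2 ≤ biPermSubst 2) (hfin : ∀ m, 3 ≤ m → Finite (H m)) :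
    BlockGaugeCost H := by
  refine ⟨2, 1, fun m s hm hA => ?_⟩
  rcases Nat.lt_or_ge m 3 with hlt | hge
  · obtain rfl : m = 2 := by omega
    exact ⟨4, by rw [pow_one]; omega, hasBlockGaugeRepr_anti hasBlockGaugeRepr_perPoly_two h2⟩
  · haveI := hfin m hge
    obtain ⟨A, hA⟩ := hA
    obtain ⟨s', hs', A', hA'⟩ := exists_finLift_of_isEquivariantDetRepr hA
    obtain ⟨N, hN, hB⟩ := hasBlockGaugeRepr_of_finLifts hge hA'
    exact ⟨N, by rw [pow_one]; omega, hB⟩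

/-- Theorem H (block-gauge form) at every SUB-WINDOW notch family `H ≤ 𝔖_m × 𝔖_m`. -/
theorem blockGaugeCost_of_le (hle : ∀ m, H m ≤ biPermSubst m) : BlockGaugeCost H :=
  blockGaugeCost_of_finite (hle 2) fun m _ => finite_of_le_biPermSubst (hle m)

/-- Theorem H, layering form, below the window: uniform polynomial LAYERING COST. -/
theorem layeringCost_of_le (hle : ∀ m, H m ≤ biPermSubst m) : LayeringCost H :=
  layeringCost_of_blockGaugeCost (blockGaugeCost_of_le hle)

/-- Theorem H, grading form, below the window: uniform polynomial GRADING COST. -/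
theorem gradingCost_of_le (hle : ∀ m, H m ≤ biPermSubst m) : GradingCost H :=
  gradingCost_of_blockGaugeCost (blockGaugeCost_of_le hle)

/-- Below the window layering is free: a polynomial equivariant family IS a polynomial layered family. -/
theorem layeringFree_of_le (hle : ∀ m, H m ≤ biPermSubst m) : LayeringFree H :=
  layeringFree_of_cost (layeringCost_of_le hle)

/-- Below the window grading is free. -/
theorem gradingFree_of_le (hle : ∀ m, H m ≤ biPermSubst m) : GradingFree H :=
  gradingFree_of_cost (gradingCost_of_le hle)

/-- ★ **TRANSFER at every sub-window notch**: the hardness piece `A_H` IS the layered piece `A^lay_H`. -/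
theorem eqHard_iff_layered_of_le (hle : ∀ m, H m ≤ biPermSubst m) : EqHard H ↔ EqHardLayered H :=
  eqHard_iff_layered (layeringFree_of_le hle)

/-- … and IS the graded piece `A^gr_H`. -/
theorem eqHard_iff_graded_of_le (hle : ∀ m, H m ≤ biPermSubst m) : EqHard H ↔ EqHard (graded H) :=
  eqHard_iff_graded (gradingFree_of_le hle)

/-- The polynomial families correspond: `PolyEquivariant H ↔ PolyLayered H` below the window. -/
theorem polyEquivariant_iff_polyLayered_of_le (hle : ∀ m, H m ≤ biPermSubst m) :
    PolyEquivariant H ↔ PolyLayered H :=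
  ⟨layeringFree_of_le hle, polyEquivariant_of_polyLayered⟩

/-- ★ The typed leaf suffices at every sub-window notch: superpolynomial `H_m`-equivariant ideal
width of `per_m` (`R^lay_H`) forces `A_H`.  (OPEN and INSTRUMENTABLE for `⊥ < H < 𝔖_m × 𝔖_m`;
PROVED at the window, `idealWidthSuperpoly_biPermSubst`.) -/
theorem eqHard_of_idealWidthSuperpoly_of_le (hle : ∀ m, H m ≤ biPermSubst m) (h : IdealWidthSuperpoly H) :
    EqHard H :=
  (eqHard_iff_layered_of_le hle).2 (eqHardLayered_of_idealWidthSuperpoly h)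

/-- The residual piece `L_H` below the window reads `A^lay_H → W`. -/
theorem symCheap_iff_layered_residual_of_le (hle : ∀ m, H m ≤ biPermSubst m) :
    SymCheap H ↔ (EqHardLayered H → DcPerSuperpolynomial ℂ) := by
  rw [symCheap_iff_residual, eqHard_iff_layered_of_le hle]

/-! ## §3 The two anchors: the window and the bottom

At the window the cells `EqHardBiPerm`, `EqHardLayeredBiPerm`, `EqHardBiPermGraded` are theorems
(g25–g28), so `EqHardBiPerm ↔ EqHardLayeredBiPerm`, `GradingFree biPermSubst` and
`LayeringFree biPermSubst` hold trivially and are deliberately NOT restated; the content at the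
window is the uniform COST form of Theorem H (non-vacuous: window-equivariant representations of
`per_m` exist, e.g. the Landsberg–Ressayre pairs representation of size `C(2m, m) - 1`,
`hasEquivariantDetRepr_window_of_full`). -/

/-- ★ `BlockGaugeCost biPermSubst` — the last typed stub of the cell-A skeleton (NODE-g13 §2) is a theorem. -/
theorem blockGaugeCost_biPermSubst : BlockGaugeCost biPermSubst :=
  blockGaugeCost_of_le fun _ => le_rfl

/-- ★ **THEOREM H** (`GradingCost biPermSubst`, "paper theorem of the node (to be kernelled)",
`EquivariantDialGrading`) is kernelled. -/
theorem gradingCost_biPermSubst : GradingCost biPermSubst :=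
  gradingCost_of_le fun _ => le_rfl

/-- ★ `LayeringCost biPermSubst` (NODE-g14's Theorem H, layered form) is kernelled. -/
theorem layeringCost_biPermSubst : LayeringCost biPermSubst :=
  layeringCost_of_le fun _ => le_rfl

/-- BOTTOM ANCHOR: `W ⟺ A^lay_⊥` — `dc(per_m)` is superpolynomial iff `per_m` has no
polynomial-width layered program of the `LayeredABP` shape (no symmetry imposed). -/
theorem dcPerSuperpolynomial_iff_eqHardLayered_bot :
    DcPerSuperpolynomial ℂ ↔ EqHardLayered (fun m => (⊥ : Subgroup (GL (Fin m × Fin m) ℂ))) :=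
  eqHard_bot_iff.symm.trans (eqHard_iff_layered_of_le fun _ => bot_le)

/-- BOTTOM ANCHOR, leaf form: superpolynomial PLAIN ideal width of `per_m` — a superpolynomial
lower bound on the least number of degree-`d` forms generating an ideal that contains `per_m`, at
suitable cuts `d ≤ m` — implies `W`.  (A SUFFICIENT condition for `W`; the ideal/variety method
in print reaches quadratic bounds in this currency; `W` itself is untouched.) -/
theorem dcPerSuperpolynomial_of_idealWidthSuperpoly_bot
    (h : IdealWidthSuperpoly (fun m => (⊥ : Subgroup (GL (Fin m × Fin m) ℂ)))) : DcPerSuperpolynomial ℂ :=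
  eqHard_bot_iff.mp (eqHard_of_idealWidthSuperpoly_of_le (fun _ => bot_le) h)

end

end Summit.ValiantsHypothesis.ValiantsHypothesis.Theorems.EquivariantDialNotchTransfer
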